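import Summits.CriticalPhenomena.CardyFormulaZ2.Theorems.CardyMagicRigidityMarkovCascadeDefs
import Summits.CriticalPhenomena.CardyFormulaZ2.Theorems.CardyMagicRigidityNestingRigidityOneGenerationZ2Interiors
import Literature.Probability.Percolation.FKLoopNestingIntegrable
import HarnessLib

/-!
# Outermost interface loop around a point inside a ball (`ℤ²`, mesh `1`)

Crux `Summit.CriticalPhenomena.CardyFormulaZ2.Theses.CardyMagicRigidity.NestingRigidity`
(stmt-CriticalPhenomena-4835), line `markov-cascade-one-generation`, registered helper stub
`exists_outermost_interfaceLoop` (a lattice/metric input of the cascade bookkeeping; first formal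
step of the guarded disintegration over the outermost loop around the support of a test function).

**Statement.** Fix a bond configuration `ω` of `ℤ²`, a point `z₀`, and a ball `B(c, R)`.  Among the
interface loops `γ` of `ω` (`IsInterfaceLoop ω γ`, drawn at mesh `1` and angle `0` as
`loopCurve 1 0 γ`) that wind around `z₀` (`(loopCurve 1 0 γ).wind z₀ ≠ 0`) and whose trace lies in
`B(c, R)` there is, if any, an OUTERMOST one: one whose winding interior `{z | wind z ≠ 0}` contains
the winding interior of every other such loop.

**Proof.** The candidates form a finite set: the trace of a candidate is a non-empty subset of
`B(c, R)`, hence meets the closed ball `B̄(0, ‖c‖ + R)`, and only finitely many interface loops of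
one configuration meet a given ball (`finite_setOf_isInterfaceLoop_meets`,
`Literature/Probability/Percolation/FKLoopNestingIntegrable.lean`).  A finite non-empty family of
sets has a `⊆`-maximal member (`Set.Finite.exists_maximalFor`).  A maximal candidate `γ` is
outermost: for any other candidate `γ'` the winding interiors of `γ'` and `γ` are nested or
disjoint (`interfaceLoop_interiors_nested_or_disjoint`,
`Theorems/CardyMagicRigidityNestingRigidityOneGenerationZ2Interiors.lean`); they are not disjoint
(both contain `z₀`), and `int γ ⊆ int γ'` forces `int γ' ⊆ int γ` by maximality.
-/

noncomputable section

open MeasureTheory Set Filter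
open scoped Topology BigOperators ENNReal Real

namespace Summit.CriticalPhenomena.CardyFormulaZ2.Cruxes.NestingRigidity.MarkovCascadeOneGeneration

open Literature.Probability.RandomPlanarGeometry Literature.Probability.Percolation
  Literature.Probability.LatticeModels
open Summit.CriticalPhenomena.CardyFormulaZ2.Theses.CardyMagicRigidity

/-- The interface loops of one configuration whose mesh-`1` trace lies in a ball `B(c, R)` form a
finite set (their traces meet the closed ball `B̄(0, ‖c‖ + R)`). [folklore] -/
theorem finite_setOf_isInterfaceLoop_range_subset_ball (ω : BondConfig (Site 2)) (c : ℂ) (R : ℝ) :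
    {γ : List MedialVertex | IsInterfaceLoop ω γ ∧
      (loopCurve 1 0 γ).range ⊆ Metric.ball c R}.Finite := by
  refine (finite_setOf_isInterfaceLoop_meets one_pos (‖c‖ + R) ω).subset ?_
  rintro γ ⟨hγ, hr⟩
  obtain ⟨x, hx⟩ := (loopCurve 1 0 γ).range_nonempty
  refine ⟨hγ, x, hx, ?_⟩
  have hxc : dist x c < R := Metric.mem_ball.1 (hr hx)
  rw [Metric.mem_closedBall, dist_zero_right]
  calc ‖x‖ = ‖(x - c) + c‖ := by rw [sub_add_cancel]
    _ ≤ ‖x - c‖ + ‖c‖ := norm_add_le _ _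
    _ = dist x c + ‖c‖ := by rw [dist_eq_norm]
    _ ≤ ‖c‖ + R := by linarith

/-- **Outermost interface loop around a point inside a ball.** Among the interface loops of a bond
configuration `ω` of `ℤ²` (mesh `1`, angle `0`) that wind around `z₀` and lie in `B(c, R)` there
is, if any, one whose winding interior contains the winding interiors of all the others.
[folklore] -/
theorem exists_outermost_interfaceLoop : ∀ (ω : BondConfig (Site 2)) (z₀ c : ℂ) (R : ℝ), ω ⊆ (zdGraph 2).edgeSet → (∃ γ : List MedialVertex, IsInterfaceLoop ω γ ∧ (loopCurve 1 0 γ).wind z₀ ≠ 0 ∧ (loopCurve 1 0 γ).range ⊆ Metric.ball c R) → ∃ γ : List MedialVertex, IsInterfaceLoop ω γ ∧ (loopCurve 1 0 γ).wind z₀ ≠ 0 ∧ (loopCurve 1 0 γ).range ⊆ Metric.ball c R ∧ ∀ γ' : List MedialVertex, IsInterfaceLoop ω γ' → (loopCurve 1 0 γ').wind z₀ ≠ 0 → (loopCurve 1 0 γ').range ⊆ Metric.ball c R → {z | (loopCurve 1 0 γ').wind z ≠ 0} ⊆ {z | (loopCurve 1 0 γ).wind z ≠ 0} := by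
  intro ω z₀ c R _hω hex
  obtain ⟨γ₀, h₀, hw₀, hr₀⟩ := hex
  -- the finite, non-empty set of candidates
  set S : Set (List MedialVertex) := {γ | IsInterfaceLoop ω γ ∧ (loopCurve 1 0 γ).wind z₀ ≠ 0 ∧
      (loopCurve 1 0 γ).range ⊆ Metric.ball c R} with hS
  have hSfin : S.Finite :=
    (finite_setOf_isInterfaceLoop_range_subset_ball ω c R).subset fun γ hγ ↦ ⟨hγ.1, hγ.2.2⟩
  -- a candidate with `⊆`-maximal winding interior
  obtain ⟨γ, hγS, hmax⟩ := hSfin.exists_maximalFor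
    (fun γ' : List MedialVertex ↦ {z | (loopCurve 1 0 γ').wind z ≠ 0}) S ⟨γ₀, h₀, hw₀, hr₀⟩
  refine ⟨γ, hγS.1, hγS.2.1, hγS.2.2, fun γ' hγ' hw' hr' ↦ ?_⟩
  rcases interfaceLoop_interiors_nested_or_disjoint ω γ' γ hγ' hγS.1 with h | h | h
  · exact h
  · exact hmax ⟨hγ', hw', hr'⟩ h
  · exact (Set.disjoint_left.1 h hw' hγS.2.1).elim

end Summit.CriticalPhenomena.CardyFormulaZ2.Cruxes.NestingRigidity.MarkovCascadeOneGeneration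

end
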